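import Summits.AtomisticToContinuum.Crystallization.Theorems.ChargedEnergyGapRhoCovariantA
import HarnessLib

/-!
# (T¹ᶜ) station certificates — NODE 113V «RhoCovariant»: the ρ-covariant cap comparison, unit level + subsumption + audit (lens-3 g98; file 2 of 2)

decomp-a2c lens-3 g98.  Line of record `stmt-AtomisticToContinuum-14231` (route PricedLinkCensus r3), deciding leaf
(T¹ᶜ) `StencilChartLawQ 130 (1/60000000) 160 (3/100) (679/1000) (691/1000)`; residual of record = 7 zone laws + the ridge atlas
(113S `stencilChartLawQ_designate_of_residual`), whose leaves close from landed 113L `ZUnit` laws.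

## The finding (FINDING «RHO-LOSS», g98)

In every checker of record (108C `CostCellCert.capCheck`, 110E, 113B/D/F/I/K/L) the unit law on a slab `ρ ∈ [ρ₀, ρ₁]` is certified by the chain
`cost(ρ, dt) ≤ (τ·2ρ₁)²·roofVal(vtxW dt) ≤ (τ·2ρ₁)²·R ≤ capLB·u ≤ κ(hi)·(u/10 + 1.03·(τ·2ρ₀)²·Bmin) ≤ domCapK u … ρ t`:
the COST prefactor is taken at the TOP of the slab (`kfac = (τ·2ρ₁)²`) and the CAP prefactor at the BOTTOM (`(τ·2ρ₀)²`).  Since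
`cost(ρ, dt) = (τ·2ρ)²·roofVal(vtxW dt)` EXACTLY (`feetHoleCost_eq_roofVal`) and the cap's bulk term carries the same `(τ·2ρ)²`, this loses the
factor `(ρ₁/ρ₀)²` against the pointwise comparison: `1.0015` on slab FD `[.6865, .687]`, `1.010–1.012` on slabs A/B/D (width .0035–.004), and
`(691/679)² = 1.0357` on the whole ρ-range — MORE than the ridge margin `1/0.9687 = 1.0323` (LEDGER v7 §1).  Consequence: a single unit over
`ρ ∈ [.679, .691]` (the WIDESLAB-98 probe) cannot close ANY ridge-tight leaf with the checkers of record, at any BSP depth.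

## The lever (this file): compare at the top of the slab on BOTH sides

For `0 < ρ ≤ ρ₁`:  `cost(ρ, dt) = (ρ/ρ₁)²·(τ·2ρ₁)²·roofVal(vtxW dt)` and
`domCapK u ϱ τ ρ t ≥ (ρ/ρ₁)²·κ(t)·u/10 + κ(t)·1.03·(τ·2ρ)²·S(ρ, t)` with `S ≥ Bmin ≥ 0` (the NODE 99 cell certificates, unchanged).  Hence the
verdict `(τ·2ρ₁)²·R ≤ capLB·u` together with the ρ-COVARIANT cap arithmetic `capLB·u ≤ κ(hi)·(u/10 + 1.03·(τ·2ρ₁)²·Bmin)` (ρ₁, not ρ₀) gives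
`(ρ/ρ₁)²·capLB·u ≤ domCapK u … ρ t` and therefore the law at every `ρ` of the slab (`capCell_lower_cov`, `sound_leafGCov`).  This is the
SHARP form: given the cell certificates, `(τ·2ρ)²·(R − 1.03·κ·Bmin) ≤ κ·u/10` for all `ρ ≤ ρ₁` iff it holds at `ρ = ρ₁`.  The ρ-width of a unit
then costs only second-order terms (charge-depth range `+Δρ`, tilt anchors over the ρ-cell, the 113F sphere rows with `ρ₀/ρ₁`), so ONE unit
per (window, band) over the full ρ-range becomes feasible where four slab units were needed: the 4-slab ridge atlas (192 leaves) collapses to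
48 leaf-columns (the mechanism the WIDESLAB probe was looking for).

## Contents — TWINS of the 113L stack with the one-token change `rho0 ↦ rho1` in the cap arithmetic; every statement of a unit law is UNCHANGED.
SPLIT-400 edition (crit-1 r1925 (B)): §113V.1–§113V.4 live in `ChargedEnergyGapRhoCovariantA` (imported), §113V.5–§113V.7 here.

* §113V.1 glue: `domCapK_nonneg`, `feetHoleCost_le_sq_ratio` (the exact covariance as the inequality used downstream), `ratio_mul_le`.
* §113V.2 `capCell_core` (NODE 99's replay up to the weight sum, once) and ★ `capCell_lower_cov`.
* §113V.3 108C twin: `CostCellCert.capCheckCov` / `capCheckCov_sound`; NODE 112 twin `capCheckCov_zero_chamber`.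
* §113V.4 113L twins: `StationCert.checkDXZCov`, `sound_leafGCov`, ★★ `sound_dietXZCov` (binders and conclusion of `sound_dietXZ` verbatim),
  `sphLaw_of_checkDXZCov`.
* §113V.5 unit twins: `ZUnit.checkCov`, `ZUnit.checkMCov`, ★★★ `ZUnit.soundCov` / `ZUnit.soundMCov` / `soundMCov_of_all` — the conclusion is the
  113L `U_law` shape verbatim, so 113N `law_of_tiles`, 113R `boxLaw_of_frame`, 113S/113U consume covariant units unchanged.
* §113V.6 subsumption: `capCheckCov_of_capCheck`, `checkDXZCov_of_checkDXZ`, `ZUnit.checkCov_of_check`, `ZUnit.checkMCov_of_checkM` — every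
  certificate of record passes the covariant checker (so the landed units ARE covariant units; nothing is re-run to switch).
* §113V.7 audit: the loss-factor arithmetic of the finding (kernel-checked rationals) and the worst-case (sharpness) lemma.

EMITTER PATCH (census / lens-5, two tokens): in the cap cell (`capcell_emit.cell`) `rhs = khi*(u/10 + 103/100*(3/100*2*r1)**2*Bmin)` (was `r0`);
in the unit file `checkDXZ ↦ checkDXZCov` (the `partK_ok` statements and `U_ok`'s part conjunction), `ZUnit.checkM ↦ ZUnit.checkMCov`,
`U.soundM ↦ U.soundMCov`.  Nothing else (rows, bases, Farkas trees, diet rows, sphere rows, cover) changes.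

No `sorry`; axioms = the standard triple.
-/

namespace Summit.AtomisticToContinuum.Crystallization.Theorems.ChargedEnergyGapChartDial

open scoped Classical
open Literature.MathematicalPhysics.StatisticalMechanics Literature.Geometry.DiscreteGeometry
open Summit.AtomisticToContinuum.Crystallization.Theses.PricedLinkCensus
open Summit.AtomisticToContinuum.Crystallization.Theorems.ChargedEnergyGapNegative

/-! ## §113V.5 The ρ-covariant flat unit (113L `ZUnit` twins; the law's statement is `U_law`'s verbatim) -/
section Unit

/-- ★ THE ρ-COVARIANT FLAT UNIT CHECKER (113L `ZUnit.check` with the parts through `checkDXZCov`). -/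
def ZUnit.checkCov (U : ZUnit) : Bool :=
  U.cover.check U.cells unitCube && U.cells.all (fun c => decide (0 ≤ c.l0 ∧ 0 ≤ c.l1 ∧ 0 ≤ c.l2)) && decide (0 ≤ U.R.rho0) &&
    U.parts.all (fun Z => (U.station Z.part).checkDXZCov U.X (sphRows Z.part.cell U.R.rho0 U.R.rho1) Z.slim)

/-- ★ THE ρ-COVARIANT FLAT MIRROR CHECKER (113L `ZUnit.checkM` with the parts through `checkDXZCov`). -/
def ZUnit.checkMCov (U : ZUnit) : Bool :=
  U.cover.check U.cellsM unitCube && U.cellsM.all (fun c => decide (0 ≤ c.l0 ∧ 0 ≤ c.l1 ∧ 0 ≤ c.l2)) && decide (0 < U.R.rho0) && U.R.symm12 &&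
    U.parts.all (fun Z => (U.station Z.part).checkDXZCov U.X (sphRows Z.part.cell U.R.rho0 U.R.rho1) Z.slim)

/-- ★★★ **SOUNDNESS OF A ρ-COVARIANT FLAT UNIT** — binders and conclusion of 113L `ZUnit.sound` verbatim. -/
theorem ZUnit.soundCov (U : ZUnit) (h : U.checkCov = true) :
    ∀ ρ : ℝ, (U.R.rho0 : ℝ) ≤ ρ → ρ ≤ U.R.rho1 → ∀ dt : (Fin 3 → ℤ) → ℝ,
      (∀ q, castW U.R.lo q ≤ dt (holeVertex 0 q) ∧ dt (holeVertex 0 q) ≤ castW U.R.hi q) → ((U.R.loC : ℝ) ≤ dt 0 ∧ dt 0 ≤ U.R.hiC) →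
      IsChartRealisable ρ dt → (∀ p ∈ stencil 0, 0 < dt p) → poleSum dt 0 ≤ poleSum dt 1 → poleSum dt 0 ≤ poleSum dt 2 →
      (∀ a : Fin 3, dt (holeVertex 0 (a, true)) ≤ dt (holeVertex 0 (a, false))) →
      feetHoleCost 160 (3 / 100) ρ dt 0 ≤ domCapK U.u 160 (3 / 100) ρ (chargeDepth ρ dt 0) := by
  simp only [ZUnit.checkCov, Bool.and_eq_true, decide_eq_true_eq] at h
  obtain ⟨⟨⟨hT, hnn⟩, hρ0⟩, hall⟩ := h
  intro ρ h₀ h₁ dt hbox hC hreal hpos hch1 hch2 hchp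
  obtain ⟨c, hc, hlo, hhi⟩ := sphere_cells_dispatch U.cells U.cover hT hnn hreal h₀ h₁ (by exact_mod_cast hρ0) hpos hchp
  obtain ⟨Z, hZ, rfl⟩ := List.mem_map.1 hc
  have hchk := List.all_eq_true.mp hall Z hZ
  exact (U.station Z.part).sphLaw_of_checkDXZCov U.X Z.part.cell Z.slim hchk ρ h₀ h₁ dt hbox hC hreal hpos hch1 hch2 hchp hlo hhi

/-- ★★★ **SOUNDNESS OF A ρ-COVARIANT FLAT MIRROR UNIT** — binders and conclusion of 113L `ZUnit.soundM` verbatim (a part's cell by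
`sphLaw_of_checkDXZCov`, a mirror cell by the law-to-law transport 113L `sphLaw_swap12`). -/
theorem ZUnit.soundMCov (U : ZUnit) (h : U.checkMCov = true) :
    ∀ ρ : ℝ, (U.R.rho0 : ℝ) ≤ ρ → ρ ≤ U.R.rho1 → ∀ dt : (Fin 3 → ℤ) → ℝ,
      (∀ q, castW U.R.lo q ≤ dt (holeVertex 0 q) ∧ dt (holeVertex 0 q) ≤ castW U.R.hi q) → ((U.R.loC : ℝ) ≤ dt 0 ∧ dt 0 ≤ U.R.hiC) →
      IsChartRealisable ρ dt → (∀ p ∈ stencil 0, 0 < dt p) → poleSum dt 0 ≤ poleSum dt 1 → poleSum dt 0 ≤ poleSum dt 2 →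
      (∀ a : Fin 3, dt (holeVertex 0 (a, true)) ≤ dt (holeVertex 0 (a, false))) →
      feetHoleCost 160 (3 / 100) ρ dt 0 ≤ domCapK U.u 160 (3 / 100) ρ (chargeDepth ρ dt 0) := by
  simp only [ZUnit.checkMCov, Bool.and_eq_true, decide_eq_true_eq] at h
  obtain ⟨⟨⟨⟨hT, hnn⟩, hρ0⟩, hs⟩, hall⟩ := h
  intro ρ h₀ h₁ dt hbox hC hreal hpos hch1 hch2 hchp
  obtain ⟨c, hc, hlo, hhi⟩ := sphere_cells_dispatch U.cellsM U.cover hT hnn hreal h₀ h₁ (by exact_mod_cast hρ0.le) hpos hchp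
  rcases List.mem_append.1 hc with hc | hc
  · obtain ⟨Z, hZ, rfl⟩ := List.mem_map.1 hc
    have hchk := List.all_eq_true.mp hall Z hZ
    exact (U.station Z.part).sphLaw_of_checkDXZCov U.X Z.part.cell Z.slim hchk ρ h₀ h₁ dt hbox hC hreal hpos hch1 hch2 hchp hlo hhi
  · obtain ⟨c', hc', rfl⟩ := List.mem_map.1 hc
    obtain ⟨Z, hZ, rfl⟩ := List.mem_map.1 hc'
    have hchk := List.all_eq_true.mp hall Z hZ
    exact StationCert.sphLaw_swap12 ((U.station Z.part).sphLaw_of_checkDXZCov U.X Z.part.cell Z.slim hchk) hs hρ0 ρ h₀ h₁ dt hbox hC hreal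
      hpos hch1 hch2 hchp hlo hhi

/-- ★ BATCH FORM over a list of ρ-covariant mirror-checked flat units. -/
theorem ZUnit.soundMCov_of_all {Us : List ZUnit} (h : Us.all ZUnit.checkMCov = true) {U : ZUnit} (hU : U ∈ Us) :
    ∀ ρ : ℝ, (U.R.rho0 : ℝ) ≤ ρ → ρ ≤ U.R.rho1 → ∀ dt : (Fin 3 → ℤ) → ℝ,
      (∀ q, castW U.R.lo q ≤ dt (holeVertex 0 q) ∧ dt (holeVertex 0 q) ≤ castW U.R.hi q) → ((U.R.loC : ℝ) ≤ dt 0 ∧ dt 0 ≤ U.R.hiC) →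
      IsChartRealisable ρ dt → (∀ p ∈ stencil 0, 0 < dt p) → poleSum dt 0 ≤ poleSum dt 1 → poleSum dt 0 ≤ poleSum dt 2 →
      (∀ a : Fin 3, dt (holeVertex 0 (a, true)) ≤ dt (holeVertex 0 (a, false))) →
      feetHoleCost 160 (3 / 100) ρ dt 0 ≤ domCapK U.u 160 (3 / 100) ρ (chargeDepth ρ dt 0) :=
  U.soundMCov (List.all_eq_true.mp h U hU)

end Unit

/-! ## §113V.6 Subsumption: every certificate of record is a ρ-covariant certificate (the covariant block is weaker) -/
section Subsumption

/-- ★ `κ(hi) ≥ 1 ≥ 0` on `ℚ`. -/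
theorem kappaQ_nonneg (hi : ℚ) : 0 ≤ kappaQ hi := le_trans zero_le_one (le_max_left _ _)

/-- ★★ The 108C cap block implies the ρ-covariant cap block (the final arithmetic is monotone in the prefactor, `ρ₀ ≤ ρ₁`). -/
theorem CostCellCert.capCheckCov_of_capCheck (c : CostCellCert) (a : Fin 3) (h : c.capCheck a = true) : c.capCheckCov a = true := by
  unfold CostCellCert.capCheck at h
  unfold CostCellCert.capCheckCov
  simp only at h ⊢
  split_ifs at h ⊢ with hk0 hk1
  · exact h
  · exact h
  · simp only [Bool.and_eq_true] at h ⊢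
    obtain ⟨⟨⟨⟨⟨hg, hP⟩, hT₁⟩, hT₂⟩, hT₃⟩, hrest⟩ := h
    obtain ⟨hB, hu, hc₀₀, hc₀₁, hc₁₀, hc₁₁, hcap⟩ := decide_eq_true_eq.mp hrest
    refine ⟨⟨⟨⟨⟨hg, hP⟩, hT₁⟩, hT₂⟩, hT₃⟩, decide_eq_true_eq.mpr ⟨hB, hu, hc₀₀, hc₀₁, hc₁₀, hc₁₁, ?_⟩⟩
    obtain ⟨h0, h1, -⟩ := decide_eq_true_eq.mp (show capGeomCheck c.rho0 c.rho1 (c.cap a).anc (c.tlo a) (c.thi a) (c.cap a).dlo (c.cap a).dhi = true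
      from hg)
    have hsq : (3 / 100 * (2 * c.rho0)) ^ 2 ≤ (3 / 100 * (2 * c.rho1)) ^ 2 :=
      pow_le_pow_left₀ (by linarith) (by linarith) 2
    have hk := kappaQ_nonneg (c.thi a)
    calc c.capLB * c.u ≤ kappaQ (c.thi a) * (c.u / 10 + 103 / 100 * ((3 / 100 * (2 * c.rho0)) ^ 2 * (c.cap a).Bmin)) := hcap
      _ ≤ kappaQ (c.thi a) * (c.u / 10 + 103 / 100 * ((3 / 100 * (2 * c.rho1)) ^ 2 * (c.cap a).Bmin)) := by
          apply mul_le_mul_of_nonneg_left _ hk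
          nlinarith [mul_le_mul_of_nonneg_right hsq hB]

/-- ★★ A station passing 113L `checkDXZ` passes `checkDXZCov`. -/
theorem StationCert.checkDXZCov_of_checkDXZ (c : StationCert) (X : DietCert) (extra : List LRow) (Bs : List BasisIdx)
    (h : c.checkDXZ X extra Bs = true) : c.checkDXZCov X extra Bs = true := by
  simp only [StationCert.checkDXZ, Bool.and_eq_true, List.all_eq_true] at h
  obtain ⟨⟨⟨⟨⟨⟨hok, hρ⟩, hboxes⟩, hcaps⟩, hc0⟩, hX⟩, htree⟩ := h
  simp only [StationCert.checkDXZCov, Bool.and_eq_true, List.all_eq_true]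
  exact ⟨⟨⟨⟨⟨⟨hok, hρ⟩, hboxes⟩, fun l hl => (c.capCertL l).capCheckCov_of_capCheck 0 (hcaps l hl)⟩,
    c.capCert.capCheckCov_of_capCheck 0 hc0⟩, hX⟩, htree⟩

/-- ★★ A unit passing 113L `ZUnit.check` passes `ZUnit.checkCov`. -/
theorem ZUnit.checkCov_of_check (U : ZUnit) (h : U.check = true) : U.checkCov = true := by
  simp only [ZUnit.check, Bool.and_eq_true, List.all_eq_true] at h
  obtain ⟨⟨⟨hT, hnn⟩, hρ0⟩, hall⟩ := h
  simp only [ZUnit.checkCov, Bool.and_eq_true, List.all_eq_true]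
  exact ⟨⟨⟨hT, hnn⟩, hρ0⟩, fun Z hZ => (U.station Z.part).checkDXZCov_of_checkDXZ U.X _ Z.slim (hall Z hZ)⟩

/-- ★★ A unit passing 113L `ZUnit.checkM` passes `ZUnit.checkMCov` — every landed flat mirror unit is a ρ-covariant unit. -/
theorem ZUnit.checkMCov_of_checkM (U : ZUnit) (h : U.checkM = true) : U.checkMCov = true := by
  simp only [ZUnit.checkM, Bool.and_eq_true, List.all_eq_true] at h
  obtain ⟨⟨⟨⟨hT, hnn⟩, hρ0⟩, hs⟩, hall⟩ := h
  simp only [ZUnit.checkMCov, Bool.and_eq_true, List.all_eq_true]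
  exact ⟨⟨⟨⟨hT, hnn⟩, hρ0⟩, hs⟩, fun Z hZ => (U.station Z.part).checkDXZCov_of_checkDXZ U.X _ Z.slim (hall Z hZ)⟩

end Subsumption

/-! ## §113V.7 Audit: the loss factor of the checkers of record vs the ridge margin (FINDING «RHO-LOSS», kernel arithmetic) -/
section Audit

/-- ★ The slab loss factors `(ρ₁/ρ₀)²` of the cost-at-`ρ₁` / cap-at-`ρ₀` comparison: FD `< 1.0015`, A/B/D `< 1.012`, the whole ρ-range `> 1.0356`
— and the ridge margin `1/0.9687 < 1.0324 < 1.0356`: the WIDESLAB probe cannot close a ridge-tight leaf under the checkers of record. -/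
theorem rhoLoss_table :
    ((687 : ℚ) / 1000) ^ 2 / ((1373 : ℚ) / 2000) ^ 2 < 10015 / 10000 ∧
    ((683 : ℚ) / 1000) ^ 2 / ((679 : ℚ) / 1000) ^ 2 < 1012 / 1000 ∧
    ((1373 : ℚ) / 2000) ^ 2 / ((683 : ℚ) / 1000) ^ 2 < 1012 / 1000 ∧
    ((691 : ℚ) / 1000) ^ 2 / ((687 : ℚ) / 1000) ^ 2 < 1012 / 1000 ∧
    10356 / 10000 < ((691 : ℚ) / 1000) ^ 2 / ((679 : ℚ) / 1000) ^ 2 ∧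
    (1 : ℚ) / (9687 / 10000) < 10324 / 10000 := by
  norm_num

/-- ★ SHARPNESS of the covariant comparison in the prefactor: for `0 ≤ ρ ≤ ρ₁`, `0 ≤ K`, `A ≤ K·B + c` with `0 ≤ c` at `ρ₁` gives
`(ρ/ρ₁)²·A ≤ K·(ρ/ρ₁)²·B + c` — the worst case of the certified inequality over the slab is its top. -/
theorem covariant_worst_case {ρ ρ₁ A B K c : ℝ} (hρ : 0 ≤ ρ) (hρ₁ : ρ ≤ ρ₁) (hc : 0 ≤ c) (h : A ≤ K * B + c) :
    (ρ / ρ₁) ^ 2 * A ≤ K * ((ρ / ρ₁) ^ 2 * B) + c := by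
  have hr0 : 0 ≤ (ρ / ρ₁) ^ 2 := sq_nonneg _
  have hr1 : (ρ / ρ₁) ^ 2 ≤ 1 := sq_ratio_le_one hρ hρ₁
  nlinarith [mul_le_mul_of_nonneg_left h hr0]

end Audit

end Summit.AtomisticToContinuum.Crystallization.Theorems.ChargedEnergyGapChartDial
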